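import Literature.AlgebraicGeometry.AbelianSchemes.AbelianSchemeKOfLFibres
import Literature.AlgebraicGeometry.AbelianSchemes.ModuleSliceOfBaseChange
import Literature.AlgebraicGeometry.AbelianSchemes.AbelianSchemeBaseChangeComp
import Literature.AlgebraicGeometry.AbelianSchemes.AbelianSchemeDualPair
import Literature.AlgebraicGeometry.AbelianVarieties.PicZeroSlicesAnyField
import Literature.AlgebraicGeometry.Modules.DetClassOfIso
import HarnessLib

/-!
# (Mc) N3′ LEVEL 0 — every GEOMETRIC point of the base lifts to the graph: a graph point `y : Spec Ω → Â′` with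
# `(1 × y)^*𝒫′ ≅ ℒ|_{A′ × x̄}` ([MumfordAV1970] §8 Thm. 1 over `Ω`; §13, proof of the Thm., level 0)

Layer `Literature/AlgebraicGeometry/AbelianSchemes`, namespace `Literature.AlgebraicGeometry.AbelianSchemes.AbelianSchemeOver`.  THEOREMS ONLY
(no definition, no named fact, no instance, no notation).  Cell `hodgecm-mathlib` (D-0151) F-3 (M)∕(Mc) book, (Mc) spine node N3′ «thickening
lifts at every point», LEVEL 0 in the SOCKET currency of the (Mc) letters (B-typ04 (g15) `STUBMENU-F3Mc-letters.v0` 4c162e6b, common prefix):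
an abelian scheme `A′/S′`, a rank-one `L′` on `A′` whose geometric fibre classes are classes of AMPLE divisors (`hΘ′`, the letters' `_hΘ` read
on `A′`), a candidate dual `Â′ = hat` with `π : A′ → Â′` and a rank-one `𝒫′ = P` on `A′ ×_{S′} Â′` with the SOCKET `(1 × π)^*𝒫′ ≅ Λ(L′)`
(`hsock`), a base `T′ → S′` and a rigidified line bundle `ℒ` on `A′ ×_{S′} T′` lying fibrewise in `Pic⁰` (`hℒ`).

* §1 `RigidifiedLineBundle.isHomogeneous_pullback_whiskerLeft_of_fibrewisePicZero` — the slice `ℒ|_{A′_s̄ × x̄}` along a geometric point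
  `x̄ : Spec Ω → T′` is homogeneous on the fibre abelian variety `A′_s̄` (`s̄ = x̄ ≫ (T′ → S′)`; transport of `ℒ.fibreModule` along ★
  `fibreBaseChangeIso`, as ★ `isHomogeneous_fibreSlice_of_fibreModule`).
* §2 **`exists_graphPoint_of_fibrewisePicZero`** — for every algebraically closed `Ω` of characteristic `0` and every geometric point
  `x : Spec Ω → T′` there is `y : Spec Ω → Â′` over `S′` with `(1_{A′} × y)^*𝒫′ ≅ (1_{A′} × x̄)^*ℒ` on `A′_s̄`:  the slice is a rank-one
  homogeneous module, hence `≅ 𝒪(t_a^*Θ − Θ)` for an `Ω`-point `a` of `A′_s̄` (★ `exists_detClass_eq_cechClass_weilDiv_of_isHomogeneous` =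
  [MumfordAV1970] §8 Thm. 1 over `Ω`, ★ `Motives/AbelianVarietyPicZeroOfAmpleAnyField`), and `y := π ∘ a`: by the socket
  `(1 × π a)^*𝒫′ ≅ (1 × a)^*Λ(L′)`, whose class is `t_a^*[Θ]·[Θ]⁻¹` (★ `pullback_whiskerLeft_mumfordClass_homMk`); rank-one modules with the same
  class are isomorphic (★ `nonempty_iso_iff_detClass_eq`).  `exists_graphPoint_of_fibrewisePicZero_of_eq` — over a prescribed base point
  `s` (`x ≫ (T′ → S′) = s`); `exists_graphPoint_of_fibrewisePicZero'` — the same in the letters' `(s̄, x̄, lift x̄ y)` spelling.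
* §3 `exists_isAmple_cechClass_fibre_baseChange` — the letters' `_hΘ` (on the fibres of `A/S`) gives `hΘ′` on the fibres of `A.baseChange p`.

HC_CM is proved only modulo the 7 printed citations until rung 0 closes; nothing here bears on a summit statement.

## References
* [MumfordAV1970] D. Mumford, *Abelian Varieties* (1970), §8 Theorem 1 (p. 77), §8 (i)–(iv) (pp. 74–75), §13 (proof of the Thm., pp. 125–130).
* [MilneAV2008] J. S. Milne, *Abelian Varieties* (2008), I §8 (pp. 36–37).
* [MumfordFogartyKirwan1994] D. Mumford, J. Fogarty, F. Kirwan, *Geometric Invariant Theory*, 3rd ed. (1994), Ch. 6 §2 Def. 6.2 (p. 120).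
-/

set_option autoImplicit false

noncomputable section

open CategoryTheory CategoryTheory.Limits AlgebraicGeometry MonoidalCategory CartesianMonoidalCategory

-- `(A.fibre s).toAbelianVariety.X.left = pullback A.X.hom s = (A.X ⊗ Over.mk s).left` hold by `rfl` only.
set_option backward.isDefEq.respectTransparency false

namespace Literature.AlgebraicGeometry.AbelianSchemes

namespace AbelianSchemeOver

open Literature.AlgebraicGeometry.Motives Literature.AlgebraicGeometry.AbelianVarieties
  Literature.AlgebraicGeometry.Modules
open scoped MonObj

variable {S' : Scheme.{0}} (A' : AbelianSchemeOver S')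

/-! ## §1 The slice of a fibrewise-`Pic⁰` bundle along a geometric point of the base is homogeneous -/

/-- **The slice `(1 × x̄)^*ℒ` on the fibre `A′_s̄` is homogeneous** for `ℒ` fibrewise in `Pic⁰` and a geometric point `x : Spec Ω → T′`
(`s̄ = x ≫ (T′ → S′)`, `x̄ = x` as an `S′`-morphism): transport of the defining condition on `ℒ.fibreModule x` along the fibre identification
`(A′ ×_{S′} T′)_x ≅ A′_s̄` (★ `fibreBaseChangeIso`). [cite: MumfordAV1970, §8 ((iv) ⇔ (i)) (pp. 74–75)] [cite: MilneAV2008, I §8 (pp. 36–37)] -/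
theorem RigidifiedLineBundle.isHomogeneous_pullback_whiskerLeft_of_fibrewisePicZero {T' : Over S'}
    (ℒ : A'.RigidifiedLineBundle T'.hom) (hℒ : ℒ.FibrewisePicZero) {Ω : Type} [Field Ω] [IsAlgClosed Ω]
    (x : Spec (.of Ω) ⟶ T'.left) :
    IsHomogeneous (A'.fibre (x ≫ T'.hom)).toAbelianVariety
      ((Scheme.Modules.pullback (A'.X ◁ (Over.homMk x rfl : Over.mk (x ≫ T'.hom) ⟶ T')).left).obj ℒ.L) := by
  have h := hℒ Ω x
  have hcond : pullback.fst (A'.baseChange T'.hom).X.hom x ≫ pullback.snd A'.X.hom T'.hom =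
      pullback.snd (A'.baseChange T'.hom).X.hom x ≫ x := pullback.condition
  have hc : AbelianVariety.Hom.toSchemeHom (A'.fibreBaseChangeIso T'.hom x).hom ≫
      (A'.X ◁ (Over.homMk x rfl : Over.mk (x ≫ T'.hom) ⟶ T')).left = pullback.fst (A'.baseChange T'.hom).X.hom x := by
    apply pullback.hom_ext
    · rw [Category.assoc, Over.whiskerLeft_left_fst]
      exact A'.fibreBaseChangeIso_hom_toSchemeHom_fst T'.hom x
    · rw [Category.assoc, Over.whiskerLeft_left_snd, ← Category.assoc]
      change (AbelianVariety.Hom.toSchemeHom (A'.fibreBaseChangeIso T'.hom x).hom ≫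
        pullback.snd A'.X.hom (x ≫ T'.hom)) ≫ x = _
      rw [A'.fibreBaseChangeIso_hom_toSchemeHom_snd T'.hom x, hcond]
      rfl
  refine (isHomogeneous_pullback_iff_of_iso (A'.fibreBaseChangeIso T'.hom x) _).1 ?_
  exact (isHomogeneous_iff_of_iso _ ((Scheme.Modules.pullbackComp _ _).app ℒ.L ≪≫
    (Scheme.Modules.pullbackCongr hc).app ℒ.L)).2 h

/-! ## §2 The graph point over a geometric point -/

/-- **N3′ LEVEL 0 — a GRAPH POINT over every geometric point of the base.**  `A′/S′` an abelian scheme, `L′` a rank-one module on `A′` whose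
geometric fibre classes are classes of ample divisors (`hΘ′`), `π : A′ → Â′`, `𝒫′` rank one on `A′ ×_{S′} Â′` with the socket `(1 × π)^*𝒫′ ≅ Λ(L′)`
(`hsock`), `ℒ` a rigidified line bundle on `A′ ×_{S′} T′` fibrewise in `Pic⁰`.  Then for every algebraically closed `Ω` of characteristic `0` and
every `x : Spec Ω → T′` there is `y : Spec Ω → Â′` over `S′` with `(1_{A′} × y)^*𝒫′ ≅ (1_{A′} × x̄)^*ℒ` on `A′_s̄` — the slice of `ℒ` is a
Mumford bundle `𝒪(t_a^*Θ − Θ)` ([MumfordAV1970] §8 Thm. 1 over `Ω`, ★ `exists_detClass_eq_cechClass_weilDiv_of_isHomogeneous`) and `y = π(a)`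
by the socket (★ `pullback_whiskerLeft_mumfordClass_homMk`, ★ `nonempty_iso_iff_detClass_eq`).
[cite: MumfordAV1970, §8 Theorem 1 (p. 77) and §13 (proof of the Thm., pp. 125–130)] [cite: MilneAV2008, I §8 (pp. 36–37)] -/
theorem exists_graphPoint_of_fibrewisePicZero {L' : A'.left.Modules} (hL' : HasRank L' 1)
    (hΘ' : ∀ ⦃Ω : Type⦄ [Field Ω] [IsAlgClosed Ω] (s : Spec (.of Ω) ⟶ S'),
      ∃ Θ : CartierDivisor (A'.fibre s).toAbelianVariety.X.left, Θ.IsAmple ∧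
        CechPic.pullback (X := (A'.fibre s).toAbelianVariety.X.left) (pullback.fst A'.X.hom s)
          (detClass (HasRank.isFiniteLocallyFree' hL')) = Θ.cechClass)
    (hat : AbelianSchemeOver S') (π : A'.X ⟶ hat.X) (P : (A'.prodLeft hat).Modules) (hP1 : HasRank P 1)
    (hsock : Nonempty ((Scheme.Modules.pullback (A'.X ◁ π).left).obj P ≅ A'.mumfordBundle L'))
    {T' : Over S'} (ℒ : A'.RigidifiedLineBundle T'.hom) (hℒ : ℒ.FibrewisePicZero)
    {Ω : Type} [Field Ω] [IsAlgClosed Ω] [CharZero Ω] (x : Spec (.of Ω) ⟶ T'.left) :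
    ∃ y : Over.mk (x ≫ T'.hom) ⟶ hat.X,
      Nonempty ((Scheme.Modules.pullback (A'.baseChangeToProd hat (x ≫ T'.hom) y.left (Over.w y))).obj P ≅
        (Scheme.Modules.pullback (A'.X ◁ (Over.homMk x rfl : Over.mk (x ≫ T'.hom) ⟶ T')).left).obj ℒ.L) := by
  classical
  -- the fibre abelian variety `X = A′_s̄` over `Ω` and the slice `E = (1 × x̄)^*ℒ` on it
  obtain ⟨Θ, hΘamp, hΘc⟩ := hΘ' (x ≫ T'.hom)
  have hE1 : HasRank ((Scheme.Modules.pullback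
      (A'.X ◁ (Over.homMk x rfl : Over.mk (x ≫ T'.hom) ⟶ T')).left).obj ℒ.L) 1 :=
    hasRank_pullback _ ℒ.hasRank_one
  have hhom := RigidifiedLineBundle.isHomogeneous_pullback_whiskerLeft_of_fibrewisePicZero A' ℒ hℒ x
  -- [MumfordAV1970] §8 Thm. 1 over `Ω`: `[E] = [𝒪(t_a^*Θ − Θ)]`
  obtain ⟨a, ha⟩ := exists_detClass_eq_cechClass_weilDiv_of_isHomogeneous (A'.fibre (x ≫ T'.hom)).toAbelianVariety hΘamp hE1 hhom
  -- the graph point `y := π(a)`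
  let â : Over.mk (x ≫ T'.hom) ⟶ A'.X :=
    Over.homMk (A'.fibrePointToLeft (x ≫ T'.hom) a) (A'.fibrePointToLeft_comp_hom (x ≫ T'.hom) a)
  refine ⟨â ≫ π, ?_⟩
  -- `(1 × π a)^*𝒫′ ≅ (1 × a)^*(1 × π)^*𝒫′ ≅ (1 × a)^*Λ(L′)`
  have hb : A'.baseChangeToProd hat (x ≫ T'.hom) (â ≫ π).left (Over.w (â ≫ π)) = (A'.X ◁ (â ≫ π)).left :=
    A'.baseChangeToProd_eq_whiskerLeft_left hat (â ≫ π)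
  have hcomp : (A'.X ◁ (â ≫ π)).left = (A'.X ◁ â).left ≫ (A'.X ◁ π).left := by
    rw [MonoidalCategory.whiskerLeft_comp, Over.comp_left]
  let e₁ : (Scheme.Modules.pullback (A'.baseChangeToProd hat (x ≫ T'.hom) (â ≫ π).left (Over.w (â ≫ π)))).obj P ≅
      (Scheme.Modules.pullback (A'.X ◁ â).left).obj (A'.mumfordBundle L') :=
    (Scheme.Modules.pullbackCongr (hb.trans hcomp)).app P ≪≫
      ((Scheme.Modules.pullbackComp (A'.X ◁ â).left (A'.X ◁ π).left).app P).symm ≪≫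
      (Scheme.Modules.pullback (A'.X ◁ â).left).mapIso hsock.some
  -- classes: `[(1 × a)^*Λ(L′)] = t_a^*[Θ]·[Θ]⁻¹ = [𝒪(t_a^*Θ − Θ)] = [E]`
  have hΛ : IsFiniteLocallyFree (A'.mumfordBundle L') := HasRank.isFiniteLocallyFree' (A'.hasRank_mumfordBundle hL')
  have hM1 : HasRank ((Scheme.Modules.pullback (A'.X ◁ â).left).obj (A'.mumfordBundle L')) 1 :=
    hasRank_pullback _ (A'.hasRank_mumfordBundle hL')
  have hcl : detClass (hΛ.pullback (A'.X ◁ â).left) =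
      ((A'.fibre (x ≫ T'.hom)).toAbelianVariety.weilDiv Θ a).cechClass := by
    rw [detClass_pullback _ hΛ, A'.detClass_mumfordBundle hL' hΛ,
      A'.pullback_whiskerLeft_mumfordClass_homMk (x ≫ T'.hom) (detClass (HasRank.isFiniteLocallyFree' hL')) a]
    have hΘc' : CechPic.pullback (CartesianMonoidalCategory.fst A'.X (Over.mk (x ≫ T'.hom))).left
        (detClass (HasRank.isFiniteLocallyFree' hL')) = Θ.cechClass := hΘc
    have hneg : (-Θ).cechClass = Θ.cechClass⁻¹ := by
      have h0 : (Θ + -Θ).cechClass = 1 := by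
        rw [(CartierDivisor.cechClass_eq_iff_linEquiv _ _).2
          (CartierDivisor.LinEquiv.add_neg (CartierDivisor.LinEquiv.refl Θ)), CartierDivisor.cechClass_zero]
      rw [CartierDivisor.cechClass_add] at h0
      exact eq_inv_of_mul_eq_one_right h0
    rw [hΘc', AbelianVariety.weilDiv, CartierDivisor.cechClass_add, CartierDivisor.cechClass_pullback, hneg]
    rfl
  have hP' : HasRank ((Scheme.Modules.pullback
      (A'.baseChangeToProd hat (x ≫ T'.hom) (â ≫ π).left (Over.w (â ≫ π)))).obj P) 1 := hasRank_pullback _ hP1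
  refine ⟨e₁ ≪≫ ((nonempty_iso_iff_detClass_eq hM1 hE1 (hΛ.pullback (A'.X ◁ â).left)
    (HasRank.isFiniteLocallyFree' hE1)).2 (hcl.trans ha.symm)).some⟩

/-- **N3′ LEVEL 0 over a prescribed base point** (`s : Spec Ω → S′`, `x : Spec Ω → T′` with `x ≫ (T′ → S′) = s`, `x̄ = Over.homMk x hs`): there is
`y : Over.mk s ⟶ Â′` with `(1 × y)^*𝒫′ ≅ (1 × x̄)^*ℒ` — the `subst` of `exists_graphPoint_of_fibrewisePicZero` (useful when `s` is given in another
bracketing, e.g. `Spec ι ≫ s₀`). [cite: MumfordAV1970, §8 Theorem 1 (p. 77) and §13 (proof of the Thm., pp. 125–130)] -/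
theorem exists_graphPoint_of_fibrewisePicZero_of_eq {L' : A'.left.Modules} (hL' : HasRank L' 1)
    (hΘ' : ∀ ⦃Ω : Type⦄ [Field Ω] [IsAlgClosed Ω] (s : Spec (.of Ω) ⟶ S'),
      ∃ Θ : CartierDivisor (A'.fibre s).toAbelianVariety.X.left, Θ.IsAmple ∧
        CechPic.pullback (X := (A'.fibre s).toAbelianVariety.X.left) (pullback.fst A'.X.hom s)
          (detClass (HasRank.isFiniteLocallyFree' hL')) = Θ.cechClass)
    (hat : AbelianSchemeOver S') (π : A'.X ⟶ hat.X) (P : (A'.prodLeft hat).Modules) (hP1 : HasRank P 1)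
    (hsock : Nonempty ((Scheme.Modules.pullback (A'.X ◁ π).left).obj P ≅ A'.mumfordBundle L'))
    {T' : Over S'} (ℒ : A'.RigidifiedLineBundle T'.hom) (hℒ : ℒ.FibrewisePicZero)
    {Ω : Type} [Field Ω] [IsAlgClosed Ω] [CharZero Ω] (s : Spec (.of Ω) ⟶ S') (x : Spec (.of Ω) ⟶ T'.left)
    (hs : x ≫ T'.hom = s) :
    ∃ y : Over.mk s ⟶ hat.X,
      Nonempty ((Scheme.Modules.pullback (A'.baseChangeToProd hat s y.left (Over.w y))).obj P ≅
        (Scheme.Modules.pullback (A'.X ◁ (Over.homMk x hs : Over.mk s ⟶ T')).left).obj ℒ.L) := by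
  subst hs
  exact A'.exists_graphPoint_of_fibrewisePicZero hL' hΘ' hat π P hP1 hsock ℒ hℒ x

/-- **N3′ LEVEL 0 in the letters' spelling** (`s̄ : Spec Ω → S′`, the point `x̄ = Over.homMk x hs : Over.mk s̄ ⟶ T′` of `T′` over `s̄`,
the pair `u = lift x̄ y`): there is `y : Over.mk s̄ ⟶ Â′` with
`(pullback (A′.baseChangeToProd Â′ s̄ (u ≫ snd).left _)).obj 𝒫′ ≅ (pullback (A′ ◁ (u ≫ fst)).left).obj ℒ.L`.  (For a given `x̄ : Over.mk s̄ ⟶ T′` take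
`x := x̄.left`, `hs := Over.w x̄`; then `Over.homMk x hs = x̄`.)
[cite: MumfordAV1970, §8 Theorem 1 (p. 77) and §13 (proof of the Thm., pp. 125–130)] -/
theorem exists_graphPoint_of_fibrewisePicZero' {L' : A'.left.Modules} (hL' : HasRank L' 1)
    (hΘ' : ∀ ⦃Ω : Type⦄ [Field Ω] [IsAlgClosed Ω] (s : Spec (.of Ω) ⟶ S'),
      ∃ Θ : CartierDivisor (A'.fibre s).toAbelianVariety.X.left, Θ.IsAmple ∧
        CechPic.pullback (X := (A'.fibre s).toAbelianVariety.X.left) (pullback.fst A'.X.hom s)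
          (detClass (HasRank.isFiniteLocallyFree' hL')) = Θ.cechClass)
    (hat : AbelianSchemeOver S') (π : A'.X ⟶ hat.X) (P : (A'.prodLeft hat).Modules) (hP1 : HasRank P 1)
    (hsock : Nonempty ((Scheme.Modules.pullback (A'.X ◁ π).left).obj P ≅ A'.mumfordBundle L'))
    {T' : Over S'} (ℒ : A'.RigidifiedLineBundle T'.hom) (hℒ : ℒ.FibrewisePicZero)
    {Ω : Type} [Field Ω] [IsAlgClosed Ω] [CharZero Ω] (s : Spec (.of Ω) ⟶ S') (x : Spec (.of Ω) ⟶ T'.left)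
    (hs : x ≫ T'.hom = s) :
    ∃ y : Over.mk s ⟶ hat.X,
      Nonempty ((Scheme.Modules.pullback (A'.baseChangeToProd hat (Over.mk s).hom
          (CartesianMonoidalCategory.lift (Over.homMk x hs : Over.mk s ⟶ T') y ≫ CartesianMonoidalCategory.snd T' hat.X).left
          (Over.w (CartesianMonoidalCategory.lift (Over.homMk x hs : Over.mk s ⟶ T') y ≫
            CartesianMonoidalCategory.snd T' hat.X)))).obj P ≅
        (Scheme.Modules.pullback (A'.X ◁ (CartesianMonoidalCategory.lift (Over.homMk x hs : Over.mk s ⟶ T') y ≫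
          CartesianMonoidalCategory.fst T' hat.X)).left).obj ℒ.L) := by
  subst hs
  obtain ⟨y, ⟨e⟩⟩ := A'.exists_graphPoint_of_fibrewisePicZero hL' hΘ' hat π P hP1 hsock ℒ hℒ x
  refine ⟨y, ⟨?_ ≪≫ e ≪≫ ?_⟩⟩
  · exact (Scheme.Modules.pullbackCongr (A'.baseChangeToProd_congr hat (Over.mk (x ≫ T'.hom)).hom
      (congrArg CommaMorphism.left (CartesianMonoidalCategory.lift_snd (Over.homMk x rfl : Over.mk (x ≫ T'.hom) ⟶ T') y))
      _ (Over.w y))).app P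
  · exact (Scheme.Modules.pullbackCongr (congrArg (fun k => CommaMorphism.left (A'.X ◁ k))
      (CartesianMonoidalCategory.lift_fst (Over.homMk x rfl : Over.mk (x ≫ T'.hom) ⟶ T') y).symm)).app ℒ.L

/-! ## §3 The letters' `_hΘ` read on a base change `A.baseChange p` -/

/-- **Ample fibre classes survive base change of the abelian scheme**: if the rank-one `L` on `A/S` has, at every geometric point `s` of `S`, fibre
class `[L|_{A_s}] = [𝒪(Θ)]` with `Θ` ample (the (Mc) letters' `_hΘ`), then so does `(A_p → A)^*L` on `A_p = A ×_S S′` for any `p : S′ → S`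
(`(A_p)_{s′} ≅ A_{s′ ≫ p}`, ★ `fibreBaseChangeIso`; ampleness and classes pull back along the isomorphism).  This is `hΘ′` of
`exists_graphPoint_of_fibrewisePicZero` for `A′ = A.baseChange p`, `L′ = (A_p → A)^*L`.
[cite: MumfordFogartyKirwan1994, Ch. 6 §2 Definition 6.2 (p. 120)] [cite: GortzWedhorn2020, Section (4.7) (pp. 107–108)] -/
theorem exists_isAmple_cechClass_fibre_baseChange {S : Scheme.{0}} (A : AbelianSchemeOver S) {L : A.left.Modules} (hL : HasRank L 1)
    (hΘ : ∀ ⦃Ω : Type⦄ [Field Ω] [IsAlgClosed Ω] (s : Spec (.of Ω) ⟶ S),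
      ∃ Θ : CartierDivisor (A.fibre s).toAbelianVariety.X.left, Θ.IsAmple ∧
        CechPic.pullback (X := (A.fibre s).toAbelianVariety.X.left) (pullback.fst A.X.hom s)
          (detClass (HasRank.isFiniteLocallyFree' hL)) = Θ.cechClass)
    (p : S' ⟶ S) (hL' : HasRank ((Scheme.Modules.pullback (pullback.fst A.X.hom p)).obj L) 1)
    ⦃Ω : Type⦄ [Field Ω] [IsAlgClosed Ω] (s' : Spec (.of Ω) ⟶ S') :
    ∃ Θ' : CartierDivisor ((A.baseChange p).fibre s').toAbelianVariety.X.left, Θ'.IsAmple ∧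
      CechPic.pullback (X := ((A.baseChange p).fibre s').toAbelianVariety.X.left) (pullback.fst (A.baseChange p).X.hom s')
        (detClass (HasRank.isFiniteLocallyFree' hL')) = Θ'.cechClass := by
  obtain ⟨Θ, hamp, hc⟩ := hΘ (s' ≫ p)
  let e := A.fibreBaseChangeIso p s'
  haveI : IsIso (AbelianVariety.Hom.toSchemeHom e.hom) :=
    ⟨AbelianVariety.Hom.toSchemeHom e.inv, by
      change AbelianVariety.Hom.toSchemeHom (e.hom ≫ e.inv) = _; rw [e.hom_inv_id]; rfl, by
      change AbelianVariety.Hom.toSchemeHom (e.inv ≫ e.hom) = _; rw [e.inv_hom_id]; rfl⟩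
  haveI := AbelianVariety.isDominant_toSchemeHom_iso_hom e
  refine ⟨Θ.pullback (AbelianVariety.Hom.toSchemeHom e.hom), hamp.pullback _, ?_⟩
  rw [CartierDivisor.cechClass_pullback, ← hc, detClass_pullback _ (HasRank.isFiniteLocallyFree' hL), ← CechPic.pullback_comp,
    ← CechPic.pullback_comp, A.fibreBaseChangeIso_hom_toSchemeHom_fst p s']
  rfl

end AbelianSchemeOver

end Literature.AlgebraicGeometry.AbelianSchemes

end
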